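import Literature.AlgebraicGeometry.Motives.HodgeTensorProofs
import Literature.AlgebraicGeometry.Motives.HodgeTensorPowerOpposedProofs
import Literature.AlgebraicGeometry.Motives.MumfordTateInvariantsBaseChange
import HarnessLib

/-!
# The Hodge filtration of `T^{a,b}` in a graded tensor basis (Mumford–Tate invariants, step 5)

For a pure `ℚ`-Hodge structure `H` of weight `n` on a finite-dimensional `V` and a GRADED BASIS
`e` of `V_ℂ` adapted to the Hodge decomposition (`exists_basis_F_eq_span`: `F^p = span
{e σ | p ≤ deg σ}`, `conj F^p = span {e σ | deg σ ≤ n - p}`), we compute the Hodge filtration of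
`T^{a,b} = V^{⊗a} ⊗ (V^∨)^{⊗b}` (`H.tensorSpace a b`, weight `(a-b) n`) in the tensor basis
`hodgeTensorBasis e a b`, transported to `ℂ ⊗ T^{a,b}` along `hodgeTensorSpaceBaseChange` and
graded by `tensorDegree deg (β, γ) = Σₖ deg (β k) - Σₗ deg (γ l)`: `dual_F_eq_span` (the dual
basis is graded for `H^∨` with degrees `-deg`; Deligne, *Théorie de Hodge II*, 1.1.7),
`tensorSpace_F_eq_span` / `complexConj_tensorSpace_F_eq_span` (`F^p (T^{a,b}) = span {E x | p ≤
tensorDegree x}`, `conj F^q = span {E x | tensorDegree x ≤ (a-b)n - q}`; Hodge II, 1.1.12), and the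
CRITERION of Deligne, *Hodge cycles on abelian varieties*, I, proof of Prop. 3.4: a weight-`0`
rational tensor is a Hodge class of type `(0,0)` iff its complexification lies in the span of the
tensor basis vectors of total degree `0` (`tensorSpaceToBaseChange_mem_span_degree_zero`,
`mem_hodgeClasses_of_mem_span_degree_zero`).

## References

* P. Deligne, *Théorie de Hodge II*, Publ. Math. IHÉS 40 (1971), 1.1.7, 1.1.12, 1.2.5.
* P. Deligne, *Hodge cycles on abelian varieties*, LNM 900 (1982), I §3, proof of Prop. 3.4.
-/

noncomputable section

open scoped TensorProduct PiTensorProduct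

namespace Literature.AlgebraicGeometry.Motives

universe u v w

/-! ### Generic lemmas: spans of images of bases under equivalences -/

section SpanLemmas

variable {R : Type u} [CommRing R] {M : Type v} [AddCommGroup M] [Module R M]
  {N : Type w} [AddCommGroup N] [Module R N] {ι : Type*}

/-- Pulling back the span of part of a basis along an isomorphism gives the span of the
corresponding part of the transported basis. [folklore] -/
theorem comap_span_basis_image (f : M ≃ₗ[R] N) (B : Module.Basis ι R N) (X : Set ι) :
    (Submodule.span R (B '' X)).comap (f : M →ₗ[R] N) = Submodule.span R ((B.map f.symm) '' X) := by
  rw [Submodule.comap_equiv_eq_map_symm, Submodule.map_span, ← Set.image_comp]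
  rfl

/-- The span of a part of a basis meets the span of another part in the span of the common part.
[folklore] -/
theorem span_basis_image_inf (B : Module.Basis ι R M) (X Y : Set ι) :
    Submodule.span R (B '' X) ⊓ Submodule.span R (B '' Y) = Submodule.span R (B '' (X ∩ Y)) := by
  ext m
  simp only [Submodule.mem_inf, Module.Basis.mem_span_image, Set.subset_inter_iff]

/-- The image of `span (B₁ '' X) ⊗ span (B₂ '' Y)` in `M ⊗ N` is the span of the tensor basis
vectors indexed by `X ×ˢ Y`. [folklore] -/
theorem range_mapIncl_span_span {κ : Type*} (B₁ : Module.Basis ι R M) (B₂ : Module.Basis κ R N)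
    (X : Set ι) (Y : Set κ) :
    LinearMap.range (TensorProduct.mapIncl (Submodule.span R (B₁ '' X)) (Submodule.span R (B₂ '' Y))) =
      Submodule.span R ((B₁.tensorProduct B₂) '' (X ×ˢ Y)) := by
  rw [TensorProduct.range_mapIncl, Submodule.map₂_span_span, Set.image2_image_left,
    Set.image2_image_right, ← Set.image_prod]
  congr 1
  refine Set.image_congr fun x _ => ?_
  simp [Module.Basis.tensorProduct_apply']

/-- A linear form vanishes on the span of a set iff it vanishes on the set. [folklore] -/
theorem forall_mem_span_apply_eq_zero_iff {K : Type*} [Field K] {W : Type*} [AddCommGroup W]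
    [Module K W] (f : Module.Dual K W) (s : Set W) :
    (∀ w ∈ Submodule.span K s, f w = 0) ↔ ∀ w ∈ s, f w = 0 := by
  constructor
  · exact fun h w hw => h w (Submodule.subset_span hw)
  · intro h w hw
    exact (Submodule.span_le (p := LinearMap.ker f)).2 h hw

/-- `span (B₁ '' X) ⊗ span (B₂ '' Y)` (as `Submodule.map₂` of `⊗ₜ`) is the span of the tensor
basis vectors indexed by `X ×ˢ Y`. [folklore] -/
theorem map₂_mk_span_span {κ : Type*} (B₁ : Module.Basis ι R M) (B₂ : Module.Basis κ R N)
    (X : Set ι) (Y : Set κ) :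
    Submodule.map₂ (TensorProduct.mk R M N) (Submodule.span R (B₁ '' X)) (Submodule.span R (B₂ '' Y)) =
      Submodule.span R ((B₁.tensorProduct B₂) '' (X ×ˢ Y)) := by
  rw [← TensorProduct.range_mapIncl, range_mapIncl_span_span]

/-- Summing the spans of the parts `{i ≤ d₁} × {j ≤ d₂}` of a family over `p ≤ i + j` gives the
span of the part `{p ≤ d₁ + d₂}`. [folklore] -/
theorem iSup_span_image_prod_le_eq {α β : Type*} (B : α × β → M) (d₁ : α → ℤ) (d₂ : β → ℤ)
    (p : ℤ) :
    ⨆ (i : ℤ) (j : ℤ) (_ : p ≤ i + j),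
        Submodule.span R (B '' ({x | i ≤ d₁ x} ×ˢ {y | j ≤ d₂ y})) =
      Submodule.span R (B '' {z | p ≤ d₁ z.1 + d₂ z.2}) := by
  apply le_antisymm
  · refine iSup_le fun i => iSup_le fun j => iSup_le fun hij => Submodule.span_mono ?_
    refine Set.image_mono ?_
    rintro ⟨x, y⟩ ⟨hx, hy⟩
    simp only [Set.mem_setOf_eq] at hx hy ⊢
    omega
  · rw [Submodule.span_le]
    rintro _ ⟨z, hz, rfl⟩
    refine Submodule.mem_iSup_of_mem (d₁ z.1) (Submodule.mem_iSup_of_mem (d₂ z.2)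
      (Submodule.mem_iSup_of_mem hz (Submodule.subset_span ⟨z, ?_, rfl⟩)))
    exact ⟨(le_refl _ : d₁ z.1 ≤ d₁ z.1), (le_refl _ : d₂ z.2 ≤ d₂ z.2)⟩

/-- Summing the spans of the parts `{d₁ ≤ c₁ - i} × {d₂ ≤ c₂ - j}` of a family over `q ≤ i + j`
gives the span of the part `{d₁ + d₂ ≤ c₁ + c₂ - q}`. [folklore] -/
theorem iSup_span_image_prod_ge_eq {α β : Type*} (B : α × β → M) (d₁ : α → ℤ) (d₂ : β → ℤ)
    (c₁ c₂ q : ℤ) :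
    ⨆ (i : ℤ) (j : ℤ) (_ : q ≤ i + j),
        Submodule.span R (B '' ({x | d₁ x ≤ c₁ - i} ×ˢ {y | d₂ y ≤ c₂ - j})) =
      Submodule.span R (B '' {z | d₁ z.1 + d₂ z.2 ≤ c₁ + c₂ - q}) := by
  apply le_antisymm
  · refine iSup_le fun i => iSup_le fun j => iSup_le fun hij => Submodule.span_mono ?_
    refine Set.image_mono ?_
    rintro ⟨x, y⟩ ⟨hx, hy⟩
    simp only [Set.mem_setOf_eq] at hx hy ⊢
    omega
  · rw [Submodule.span_le]
    rintro _ ⟨z, hz, rfl⟩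
    refine Submodule.mem_iSup_of_mem (c₁ - d₁ z.1) (Submodule.mem_iSup_of_mem (c₂ - d₂ z.2)
      (Submodule.mem_iSup_of_mem ?_ (Submodule.subset_span ⟨z, ?_, rfl⟩)))
    · simp only [Set.mem_setOf_eq] at hz
      omega
    · exact ⟨by simp, by simp⟩

end SpanLemmas

/-! ### Graded tensor bases of `ℂ ⊗ T^{a,b}` -/

section Degree

variable {S : Type u}

/-- The **total degree** `Σₖ deg (β k) - Σₗ deg (γ l)` of a tensor basis index `(β, γ)`: the
Hodge type `P` of the tensor basis vector `(⊗ e (β k)) ⊗ (⊗ e^∨ (γ l))` when `e σ` has type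
`deg σ` (Deligne, Hodge II, 1.1.12). [folklore] -/
def tensorDegree (deg : S → ℤ) {a b : ℕ} (x : (Fin a → S) × (Fin b → S)) : ℤ :=
  (∑ k, deg (x.1 k)) - ∑ l, deg (x.2 l)

/-- Unfolding of `tensorDegree`. [folklore] -/
theorem tensorDegree_apply (deg : S → ℤ) {a b : ℕ} (x : (Fin a → S) × (Fin b → S)) :
    tensorDegree deg x = (∑ k, deg (x.1 k)) - ∑ l, deg (x.2 l) :=
  rfl

end Degree

namespace HodgeStructure

section Basis

variable {V : Type u} [AddCommGroup V] [Module ℚ V] [Module.Finite ℚ V]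
  {S : Type u} [Fintype S] [DecidableEq S]

/-- The tensor basis of `ℂ ⊗ T^{a,b} V` obtained by transporting `hodgeTensorBasis e a b` along the
comparison isomorphism `hodgeTensorSpaceBaseChange`. [folklore] -/
def hodgeTensorBasisBC (e : Module.Basis S ℂ (ℂ ⊗[ℚ] V)) (a b : ℕ) :
    Module.Basis ((Fin a → S) × (Fin b → S)) ℂ (ℂ ⊗[ℚ] hodgeTensorSpace V a b) :=
  (hodgeTensorBasis e a b).map (hodgeTensorSpaceBaseChange V a b).symm

/-- The comparison isomorphism takes `hodgeTensorBasisBC` to `hodgeTensorBasis`. [folklore] -/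
theorem hodgeTensorSpaceBaseChange_hodgeTensorBasisBC (e : Module.Basis S ℂ (ℂ ⊗[ℚ] V)) (a b : ℕ)
    (x : (Fin a → S) × (Fin b → S)) :
    hodgeTensorSpaceBaseChange V a b (hodgeTensorBasisBC e a b x) = hodgeTensorBasis e a b x := by
  rw [hodgeTensorBasisBC, Module.Basis.map_apply, LinearEquiv.apply_symm_apply]

/-- The auxiliary tensor basis of `ℂ ⊗ T^{a,b}` built factorwise from the transported bases of
`ℂ ⊗ V^{⊗a}` and `ℂ ⊗ V^{∨⊗b}` is `hodgeTensorBasisBC` (as a function). [folklore] -/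
theorem aux_basis_eq_hodgeTensorBasisBC (e : Module.Basis S ℂ (ℂ ⊗[ℚ] V)) (a b : ℕ)
    (x : (Fin a → S) × (Fin b → S)) :
    ((((Basis.piTensorProduct fun _ : Fin a => e).map (piTensorBaseChangeEquiv V (Fin a)).symm).tensorProduct
      ((Basis.piTensorProduct fun _ : Fin b => e.dualBasis.map (dualBaseChangeEquiv V).symm).map
        (piTensorBaseChangeEquiv (Module.Dual ℚ V) (Fin b)).symm)).map
        (tensorBaseChange (⨂[ℚ]^a V) (⨂[ℚ]^b (Module.Dual ℚ V))).symm) x =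
      hodgeTensorBasisBC e a b x := by
  apply (hodgeTensorSpaceBaseChange V a b).injective
  rw [hodgeTensorSpaceBaseChange_hodgeTensorBasisBC]
  obtain ⟨β, γ⟩ := x
  rw [hodgeTensorBasis_apply]
  simp only [Module.Basis.map_apply, Module.Basis.tensorProduct_apply', Basis.piTensorProduct_apply,
    hodgeTensorSpaceBaseChange, LinearEquiv.trans_apply, LinearEquiv.apply_symm_apply,
    TensorProduct.congr_tmul, PiTensorProduct.congr_tprod]

end Basis

section Filtration

variable {V : Type u} [AddCommGroup V] [Module ℚ V] [Module.Finite ℚ V] [HodgeTensorFacts.{u, u}]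
  {n : ℤ} {S : Type u} [Fintype S] [DecidableEq S] {deg : S → ℤ}

/-- **The dual basis is a graded basis of `V_ℂ^∨` for `H^∨`, with degrees `-deg`**: in terms of
the basis `e^∨' = e.dualBasis` transported to `ℂ ⊗ V^∨` along `dualBaseChange`,
`F^p (H^∨) = span {e^∨' σ | p ≤ -deg σ}` (Deligne, Hodge II, 1.1.7: `F^p V^∨ = (F^{1-p} V)^⊥`, and
`e^∨_σ` kills `F^{1-p} = span {e τ | 1 - p ≤ deg τ}` iff `deg σ < 1 - p`).
[cite: DeligneHodgeII1971, 1.1.7] -/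
theorem dual_F_eq_span (H : HodgeStructure V n) (e : Module.Basis S ℂ (ℂ ⊗[ℚ] V))
    (hF : ∀ a, H.F a = Submodule.span ℂ (e '' {σ | a ≤ deg σ})) (a : ℤ) :
    H.dual.F a = Submodule.span ℂ
      ((e.dualBasis.map (dualBaseChangeEquiv V).symm) '' {σ | a ≤ -deg σ}) := by
  have key : ((H.F (1 - a)).dualAnnihilator : Submodule ℂ (Module.Dual ℂ (ℂ ⊗[ℚ] V))) =
      Submodule.span ℂ (e.dualBasis '' {σ | a ≤ -deg σ}) := by
    ext ξ
    rw [Submodule.mem_dualAnnihilator, hF, forall_mem_span_apply_eq_zero_iff,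
      Module.Basis.mem_span_image]
    simp only [Set.forall_mem_image, Set.mem_setOf_eq, Set.subset_def, Finset.mem_coe,
      Finsupp.mem_support_iff, Module.Basis.dualBasis_repr]
    constructor
    · intro h σ hσ
      by_contra hlt
      exact hσ (h (by omega))
    · intro h σ hσ
      by_contra hne
      have := h σ hne
      omega
  rw [dual_F, dualFiltration, key]
  exact comap_span_basis_image (dualBaseChangeEquiv V) e.dualBasis _

/-- Conjugate version: `conj F^p (H^∨) = span {e^∨' σ | -deg σ ≤ -n - p}` (from
`conj F^{1-p} = span {e τ | deg τ ≤ n - 1 + p}` and `conj ((F^{1-p})^⊥) = (conj F^{1-p})^⊥`,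
`complexConj_dualFiltration`). [cite: DeligneHodgeII1971, 1.1.7] -/
theorem complexConj_dual_F_eq_span (H : HodgeStructure V n) (e : Module.Basis S ℂ (ℂ ⊗[ℚ] V))
    (hFc : ∀ a, complexConj (H.F a) = Submodule.span ℂ (e '' {σ | deg σ ≤ n - a})) (a : ℤ) :
    complexConj (H.dual.F a) = Submodule.span ℂ
      ((e.dualBasis.map (dualBaseChangeEquiv V).symm) '' {σ | -deg σ ≤ -n - a}) := by
  have key : ((complexConj (H.F (1 - a))).dualAnnihilator :
      Submodule ℂ (Module.Dual ℂ (ℂ ⊗[ℚ] V))) =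
      Submodule.span ℂ (e.dualBasis '' {σ | -deg σ ≤ -n - a}) := by
    ext ξ
    rw [Submodule.mem_dualAnnihilator, hFc, forall_mem_span_apply_eq_zero_iff,
      Module.Basis.mem_span_image]
    simp only [Set.forall_mem_image, Set.mem_setOf_eq, Set.subset_def, Finset.mem_coe,
      Finsupp.mem_support_iff, Module.Basis.dualBasis_repr]
    constructor
    · intro h σ hσ
      by_contra hlt
      exact hσ (h (by omega))
    · intro h σ hσ
      by_contra hne
      have := h σ hne
      omega
  rw [dual_F, complexConj_dualFiltration, key]
  exact comap_span_basis_image (dualBaseChangeEquiv V) e.dualBasis _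

/-! ### The filtration of `T^{a,b}` in the graded tensor basis -/

/-- **The Hodge filtration of `T^{a,b}` in the graded tensor basis** (Deligne, Hodge II, 1.1.12
with 1.1.7; the tensor basis vector indexed by `x` has Hodge type `P = tensorDegree deg x`):
`F^p (T^{a,b} H) = span {E x | p ≤ tensorDegree deg x}`, `E = hodgeTensorBasisBC e a b`.
[cite: DeligneHodgeII1971, 1.1.12] -/
theorem tensorSpace_F_eq_span (H : HodgeStructure V n) (e : Module.Basis S ℂ (ℂ ⊗[ℚ] V))
    (hF : ∀ a, H.F a = Submodule.span ℂ (e '' {σ | a ≤ deg σ})) (a b : ℕ) (p : ℤ) :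
    (H.tensorSpace a b).F p =
      Submodule.span ℂ (hodgeTensorBasisBC e a b '' {x | p ≤ tensorDegree deg x}) := by
  have hA : ∀ i, (H.tensorPower a).F i = Submodule.span ℂ
      (((Basis.piTensorProduct fun _ : Fin a => e).map (piTensorBaseChangeEquiv V (Fin a)).symm) ''
        {β | i ≤ ∑ k, deg (β k)}) := fun i => by
    rw [tensorPower_F, tensorPowerFiltration_eq_comap_span H e hF a i]
    exact comap_span_basis_image (piTensorBaseChangeEquiv V (Fin a)) _ _
  have hB : ∀ j, (H.dual.tensorPower b).F j = Submodule.span ℂ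
      (((Basis.piTensorProduct fun _ : Fin b => e.dualBasis.map (dualBaseChangeEquiv V).symm).map
        (piTensorBaseChangeEquiv (Module.Dual ℚ V) (Fin b)).symm) ''
        {γ | j ≤ ∑ l, -deg (γ l)}) := fun j => by
    rw [tensorPower_F, tensorPowerFiltration_eq_comap_span H.dual
      (e.dualBasis.map (dualBaseChangeEquiv V).symm) (dual_F_eq_span H e hF) b j]
    exact comap_span_basis_image (piTensorBaseChangeEquiv (Module.Dual ℚ V) (Fin b)) _ _
  change ((H.tensorPower a).tensor (H.dual.tensorPower b)).F p = _
  rw [tensor_F, tensorFiltration]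
  simp_rw [TensorProduct.range_mapIncl, hA, hB, map₂_mk_span_span, comap_span_basis_image]
  simp_rw [show ∀ X : Set ((Fin a → S) × (Fin b → S)),
      ((((Basis.piTensorProduct fun _ : Fin a => e).map (piTensorBaseChangeEquiv V (Fin a)).symm).tensorProduct
        ((Basis.piTensorProduct fun _ : Fin b => e.dualBasis.map (dualBaseChangeEquiv V).symm).map
          (piTensorBaseChangeEquiv (Module.Dual ℚ V) (Fin b)).symm)).map
        (tensorBaseChange (⨂[ℚ]^a V) (⨂[ℚ]^b (Module.Dual ℚ V))).symm) '' X =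
      hodgeTensorBasisBC e a b '' X from
    fun X => Set.image_congr fun x _ => aux_basis_eq_hodgeTensorBasisBC e a b x]
  rw [iSup_span_image_prod_le_eq]
  congr 2
  ext x
  simp only [Set.mem_setOf_eq, tensorDegree_apply, Finset.sum_neg_distrib]
  omega

/-- **The conjugate filtration of `T^{a,b}` in the graded tensor basis**:
`conj F^q (T^{a,b} H) = span {E x | tensorDegree deg x ≤ (a - b) n - q}` (Deligne, Hodge II,
1.1.12 and 1.2.5: `conj F^q = ⊕_{P ≤ w - q}` for a Hodge structure of weight `w = (a-b) n`).
[cite: DeligneHodgeII1971, 1.1.12 and 1.2.5] -/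
theorem complexConj_tensorSpace_F_eq_span (H : HodgeStructure V n) (e : Module.Basis S ℂ (ℂ ⊗[ℚ] V))
    (hFc : ∀ a, complexConj (H.F a) = Submodule.span ℂ (e '' {σ | deg σ ≤ n - a})) (a b : ℕ)
    (q : ℤ) :
    complexConj ((H.tensorSpace a b).F q) =
      Submodule.span ℂ (hodgeTensorBasisBC e a b ''
        {x | tensorDegree deg x ≤ ((a : ℤ) - b) * n - q}) := by
  have hA : ∀ i, complexConj ((H.tensorPower a).F i) = Submodule.span ℂ
      (((Basis.piTensorProduct fun _ : Fin a => e).map (piTensorBaseChangeEquiv V (Fin a)).symm) ''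
        {β | ∑ k, deg (β k) ≤ a * n - i}) := fun i => by
    rw [tensorPower_F, complexConj_tensorPowerFiltration_eq_comap_span H e hFc a i]
    exact comap_span_basis_image (piTensorBaseChangeEquiv V (Fin a)) _ _
  have hB : ∀ j, complexConj ((H.dual.tensorPower b).F j) = Submodule.span ℂ
      (((Basis.piTensorProduct fun _ : Fin b => e.dualBasis.map (dualBaseChangeEquiv V).symm).map
        (piTensorBaseChangeEquiv (Module.Dual ℚ V) (Fin b)).symm) ''
        {γ | ∑ l, -deg (γ l) ≤ b * (-n) - j}) := fun j => by
    rw [tensorPower_F, complexConj_tensorPowerFiltration_eq_comap_span H.dual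
      (e.dualBasis.map (dualBaseChangeEquiv V).symm) (complexConj_dual_F_eq_span H e hFc) b j]
    exact comap_span_basis_image (piTensorBaseChangeEquiv (Module.Dual ℚ V) (Fin b)) _ _
  change complexConj (((H.tensorPower a).tensor (H.dual.tensorPower b)).F q) = _
  rw [tensor_F]
  simp only [tensorFiltration, TensorProduct.range_mapIncl, ← complexConjOrderIso_apply,
    OrderIso.map_iSup]
  simp only [complexConjOrderIso_apply, complexConj_comap_map₂_mk]
  simp_rw [hA, hB, map₂_mk_span_span, comap_span_basis_image]
  simp_rw [show ∀ X : Set ((Fin a → S) × (Fin b → S)),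
      ((((Basis.piTensorProduct fun _ : Fin a => e).map (piTensorBaseChangeEquiv V (Fin a)).symm).tensorProduct
        ((Basis.piTensorProduct fun _ : Fin b => e.dualBasis.map (dualBaseChangeEquiv V).symm).map
          (piTensorBaseChangeEquiv (Module.Dual ℚ V) (Fin b)).symm)).map
        (tensorBaseChange (⨂[ℚ]^a V) (⨂[ℚ]^b (Module.Dual ℚ V))).symm) '' X =
      hodgeTensorBasisBC e a b '' X from
    fun X => Set.image_congr fun x _ => aux_basis_eq_hodgeTensorBasisBC e a b x]
  rw [iSup_span_image_prod_ge_eq]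
  congr 2
  ext x
  simp only [Set.mem_setOf_eq, tensorDegree_apply, Finset.sum_neg_distrib]
  constructor <;> intro h <;> linarith

/-! ### The Hodge-class criterion in the tensor basis -/

/-- **A weight-`0` Hodge class of type `(0,0)` complexifies into the degree-`0` part of the tensor
basis** (rational ⇒ real: `1 ⊗ t ∈ F^0 ∩ conj F^0 = span {E x | tensorDegree x = 0}`; Deligne,
LNM 900, I, proof of 3.4: a rational tensor is of type `(0,0)` iff it lies in `T^{0,0}`).
[cite: Deligne1982HodgeCycles, I proof of Prop. 3.4] -/
theorem one_tmul_mem_span_degree_zero (H : HodgeStructure V n) (e : Module.Basis S ℂ (ℂ ⊗[ℚ] V))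
    (hF : ∀ a, H.F a = Submodule.span ℂ (e '' {σ | a ≤ deg σ}))
    (hFc : ∀ a, complexConj (H.F a) = Submodule.span ℂ (e '' {σ | deg σ ≤ n - a})) {a b : ℕ}
    (hab : ((a : ℤ) - b) * n = 0) {t : hodgeTensorSpace V a b}
    (ht : t ∈ (H.tensorSpace a b).hodgeClasses 0) :
    (1 : ℂ) ⊗ₜ[ℚ] t ∈ Submodule.span ℂ (hodgeTensorBasisBC e a b '' {x | tensorDegree deg x = 0}) := by
  have h1 : (1 : ℂ) ⊗ₜ[ℚ] t ∈ (H.tensorSpace a b).F 0 := ht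
  have h2 : (1 : ℂ) ⊗ₜ[ℚ] t ∈ complexConj ((H.tensorSpace a b).F 0) := by
    rw [mem_complexConj, conj_tmul, map_one]
    exact h1
  rw [tensorSpace_F_eq_span H e hF] at h1
  rw [complexConj_tensorSpace_F_eq_span H e hFc, hab] at h2
  have h := Submodule.mem_inf.2 ⟨h1, h2⟩
  rw [span_basis_image_inf] at h
  have hset : ({x | (0 : ℤ) ≤ tensorDegree deg x} ∩ {x | tensorDegree deg x ≤ 0 - 0} :
      Set ((Fin a → S) × (Fin b → S))) = {x | tensorDegree deg x = 0} := by
    ext x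
    simp only [Set.mem_setOf_eq, Set.mem_inter_iff]
    omega
  rwa [hset] at h

/-- Transported version: the complexification `ι t` of a weight-`0` Hodge class of type `(0,0)`
lies in the span of the tensor basis vectors `hodgeTensorBasis e a b x` of total degree `0`.
[cite: Deligne1982HodgeCycles, I proof of Prop. 3.4] -/
theorem tensorSpaceToBaseChange_mem_span_degree_zero (H : HodgeStructure V n)
    (e : Module.Basis S ℂ (ℂ ⊗[ℚ] V))
    (hF : ∀ a, H.F a = Submodule.span ℂ (e '' {σ | a ≤ deg σ}))
    (hFc : ∀ a, complexConj (H.F a) = Submodule.span ℂ (e '' {σ | deg σ ≤ n - a})) {a b : ℕ}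
    (hab : ((a : ℤ) - b) * n = 0) {t : hodgeTensorSpace V a b}
    (ht : t ∈ (H.tensorSpace a b).hodgeClasses 0) :
    tensorSpaceToBaseChange ℂ V a b t ∈
      Submodule.span ℂ (hodgeTensorBasis e a b '' {x | tensorDegree deg x = 0}) := by
  rw [← hodgeTensorSpaceBaseChange_one_tmul]
  have h := Submodule.mem_map_of_mem (f := (hodgeTensorSpaceBaseChange V a b).toLinearMap)
    (one_tmul_mem_span_degree_zero H e hF hFc hab ht)
  rw [Submodule.map_span, ← Set.image_comp] at h
  have hfun : (⇑(hodgeTensorSpaceBaseChange V a b).toLinearMap ∘ ⇑(hodgeTensorBasisBC e a b)) =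
      ⇑(hodgeTensorBasis e a b) :=
    funext fun x => hodgeTensorSpaceBaseChange_hodgeTensorBasisBC e a b x
  rw [hfun] at h
  exact h

/-- **Converse**: a rational tensor whose complexification lies in the span of the tensor basis
vectors of total degree `0` is a Hodge class of type `(0,0)` (it lies in `F^0 = span {0 ≤ deg}`).
No weight hypothesis is needed. [cite: Deligne1982HodgeCycles, I proof of Prop. 3.4] -/
theorem mem_hodgeClasses_of_mem_span_degree_zero (H : HodgeStructure V n)
    (e : Module.Basis S ℂ (ℂ ⊗[ℚ] V))
    (hF : ∀ a, H.F a = Submodule.span ℂ (e '' {σ | a ≤ deg σ})) {a b : ℕ} {t : hodgeTensorSpace V a b}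
    (h : tensorSpaceToBaseChange ℂ V a b t ∈
      Submodule.span ℂ (hodgeTensorBasis e a b '' {x | tensorDegree deg x = 0})) :
    t ∈ (H.tensorSpace a b).hodgeClasses 0 := by
  change (1 : ℂ) ⊗ₜ[ℚ] t ∈ (H.tensorSpace a b).F 0
  rw [tensorSpace_F_eq_span H e hF]
  have h' := Submodule.mem_map_of_mem (f := (hodgeTensorSpaceBaseChange V a b).symm.toLinearMap) h
  rw [Submodule.map_span, ← Set.image_comp, LinearEquiv.coe_coe,
    ← hodgeTensorSpaceBaseChange_one_tmul, LinearEquiv.symm_apply_apply] at h'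
  refine Submodule.span_mono ?_ h'
  rintro _ ⟨x, hx, rfl⟩
  refine ⟨x, ?_, ?_⟩
  · simp only [Set.mem_setOf_eq] at hx ⊢
    omega
  · rw [Function.comp_apply, ← hodgeTensorSpaceBaseChange_hodgeTensorBasisBC,
      LinearEquiv.symm_apply_apply]

end Filtration

end HodgeStructure

end Literature.AlgebraicGeometry.Motives

end
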